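/-
Copyright (c) 2026 the pub-hodgecm-mathlib formalisation cell (harness21).  Prover seat hodgecm-mathlib-K2E3-p06 (g2), Track B «K2-LIT» ∕ h413,
ENGINE E3 unit U4 «Keys», SIGS-TABLE row #6 `sig_K2E3IrregularReducibleCaseThree` — analytic letter hKP, brick F4c (the dual zeta integral `Z(ĝ_T, χ⁻¹, 1)` in closed form).
-/
import Summits.HodgeConjecture.HodgeConjecture.Theorems.K2E3TwoBumpTransform   -- ★ brick F4b (this seat): the two-bump transform; brings ★ F2 ∕ F3 ∕ F4
import HarnessLib

/-!
# K2 · E3 · U4 «Keys», row #6 — brick F4c: the DUAL ZETA INTEGRAL of Tate's trick in closed form —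
# `∫_E (g_T)^(β) D̄(β) dμ_E = μ⁻(B_T) μ⁻(Ann_T) · μ⁺(B) μ⁺(𝔞) · (1 − D̄(c₀))`, and `μ⁻(B_T) μ⁻(Ann_T)` is bounded below uniformly in `T = ‖l‖^k T₀` [Tate1950 §2.4–2.5; Keys1984 §5]

Cell `pub/hodgecm-mathlib` (D-0151), HCML Track B «K2-LIT», crux H413 = `stmt-HodgeConjecture-24833` (lane `--supports … --as helper`), route
HCCMUnconditional; socket `sig_K2E3IrregularReducibleCaseThree` (U4-c) of `Cruxes/H413/Lines/K2_E3_EllipticInputsSigs_U4Keys.lean`.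
THEOREMS ONLY (0 def ∕ 0 instance ∕ 0 notation ∕ 0 sorry); ★-only imports.  FRAME of ★ bricks F2–F4b; `g_T(x) = Φ(Re x) 𝟙[‖Im x‖ ≤ T]` with the two-bump `Φ` of ★ F4b,
`ψ` a continuous `σ`-even additive character, `D̄ : E → ℂ` bounded measurable multiplicative with `D̄(1 + t) = 1` for `‖t‖ ≤ r₁` (for hKP: `D̄ = χ̄₁`, `D̄(c₀) = −1`).
* §1 `integral_skewBall_addChar_mul_eq_mul_indicator` (`W_T(y') = μ⁻(B_T) · 𝟙_{Ann_T}(y')`), `measurableSet_skewAnn`, `integral_W_eq` (`∫ W_T = μ⁻(B_T) μ⁻(Ann_T)`),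
  `skewAnn_subset_ball` (`Ann_T ⊆ {‖y'‖ < ‖a₁‖/T}`), `ball_subset_skewAnn` (`{‖y'‖ ≤ r_ψ/T} ⊆ Ann_T`);
* §2 **`integral_fourierSB_truncTest_mul_eq`** — THE CLOSED FORM (`Φ` passed as a hypothesis `hΦ : Φ = …` so the statement matches ★ F3 ∕ F4 verbatim): with ★ F4 (`(g_T)^ = F_Φ(Re) · W_T(Im)`), ★ F4b (`F_Φ` = bumps at `1`, `c₀`), and the LOCAL CONSTANCY
  `D̄(a' + y') = D̄(a')` on `supp F_Φ × Ann_T` (both bumps are `r₁`-small once `‖a₁‖/ρ ≤ r₁`, `‖a₁‖/T ≤ r₁ min(1, ‖c₀‖)`), the integrand on `E⁺ × E⁻` is a product and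
  `∫ f(a') g(y') = ∫ f · ∫ g` (no Gauss sum is ever evaluated);
* §3 `measure_skewBall_pow_mul` (`μ⁻{‖y‖ ≤ ‖l‖^k r} = χ⁻(l)^k μ⁻{‖y‖ ≤ r}`) and **`measure_skewBall_mul_measure_skewBall_eq`** — `μ⁻{‖y‖ ≤ ‖l‖^k T₀} · μ⁻{‖y‖ ≤ r/(‖l‖^k T₀)}`
  does not depend on `k`: the lower bound for `μ⁻(B_T) μ⁻(Ann_T)` along `T_k = ‖l‖^k T₀ → ∞`.
HONEST LABEL: HC_CM is proved only modulo the 7 printed citations (2 remaining named inputs: hLiu418 = `stmt-HodgeConjecture-24832`, h413 =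
`stmt-HodgeConjecture-24833`) until rung 0 closes; count-neutral analytic plumbing (no socket paid here).

## References
* [Tate1950] J. Tate, *Fourier analysis in number fields and Hecke's zeta-functions* (1950), §2.4 Lemma 2.4.3, §2.5.
* [Keys1984] D. Keys, *Principal series representations of special unitary groups over local fields*, Compositio Math. 51 (1984), §5.
* [WeilBNT1967] A. Weil, *Basic Number Theory* (1967), Ch. II §5, Ch. VII §2.
-/

set_option autoImplicit false
-- the mandated namespace has the single-problem summit's repeated segment (`HodgeConjecture.HodgeConjecture`)
set_option linter.dupNamespace false

noncomputable section

open scoped NNReal ENNReal Topology Pointwise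
open MeasureTheory Filter Set
open Literature.NumberTheory.GaloisRepresentations.IsNonarchimedeanLocalField
open Literature.NumberTheory.Automorphic
open Literature.NumberTheory.Automorphic.UnitaryGroup.HeisRing
open Summit.HodgeConjecture.HodgeConjecture.Cruxes.H413.K2E3SkewLineIntegrable
open Summit.HodgeConjecture.HodgeConjecture.Cruxes.H413.K2E3SkewLineZetaFibration
open Summit.HodgeConjecture.HodgeConjecture.Cruxes.H413.K2E3SigmaEvenCharacter
open Summit.HodgeConjecture.HodgeConjecture.Cruxes.H413.K2E3TwoBumpTransform

namespace Summit.HodgeConjecture.HodgeConjecture.Cruxes.H413.K2E3DualZetaEvaluation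

variable {E : Type*} [Field E] [ValuativeRel E] [TopologicalSpace E] [IsNonarchimedeanLocalField E]
  (σ : E →+* E) (hσ : ∀ x, σ (σ x) = x) (hσc : Continuous σ) [Invertible (2 : E)]
  (hσn : ∀ x, normAbs E (σ x) = normAbs E x)
  (ψ : AddChar E Circle) (hψc : Continuous ψ) (hψσ : ∀ x, ψ (σ x) = ψ x)
  [MeasurableSpace E] [BorelSpace E] [T2Space E] [SecondCountableTopology E]
  (μp : Measure (fixedPart σ)) [μp.IsAddHaarMeasure] [μp.Regular] (μm : Measure (skewPart σ)) [μm.IsAddHaarMeasure] [μm.Regular]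

/-! ## §1 The `E⁻`-factor `W_T` and the annihilator `Ann_T` of the `T`-ball -/

section SkewFactor

open scoped Classical in
omit [Invertible (2 : E)] [T2Space E] [SecondCountableTopology E] [μm.Regular] in
/-- **`W_T(y') = μ⁻(B_T) · 𝟙_{Ann_T}(y')`** (★ F4 orthogonality, restated with the annihilator `Ann_T = {y' : ψ(y y') = 1 ∀ y ∈ B_T}` as an indicator). [cite: Tate1950, §2.5] -/
theorem integral_skewBall_addChar_mul_eq_mul_indicator (T : ℝ≥0) (y' : skewPart σ) :
    ∫ y : skewPart σ, {y : skewPart σ | normAbs E (y : E) ≤ T}.indicator (fun y : skewPart σ => ((ψ ((y : E) * (y' : E)) : Circle) : ℂ)) y ∂μm =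
      ((μm.real {y : skewPart σ | normAbs E (y : E) ≤ T} : ℝ) : ℂ) *
        {y' : skewPart σ | ∀ y : skewPart σ, normAbs E (y : E) ≤ T → ψ ((y : E) * (y' : E)) = 1}.indicator (fun _ => (1 : ℂ)) y' := by
  rw [integral_skewBall_addChar_mul σ ψ μm T (y' : E)]
  by_cases h : ∀ y : skewPart σ, normAbs E (y : E) ≤ T → ψ ((y : E) * (y' : E)) = 1
  · rw [Set.indicator_of_mem (show y' ∈ {y' : skewPart σ | ∀ y : skewPart σ, normAbs E (y : E) ≤ T → ψ ((y : E) * (y' : E)) = 1} from h),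
      if_pos h, mul_one]
  · rw [Set.indicator_of_notMem (show y' ∉ {y' : skewPart σ | ∀ y : skewPart σ, normAbs E (y : E) ≤ T → ψ ((y : E) * (y' : E)) = 1} from h),
      if_neg h, mul_zero]

omit [Invertible (2 : E)] [T2Space E] [SecondCountableTopology E] in
include hψc in
/-- `Ann_T` is closed, hence measurable. [cite: WeilBNT1967, Ch. II §5] -/
theorem measurableSet_skewAnn (T : ℝ≥0) :
    MeasurableSet {y' : skewPart σ | ∀ y : skewPart σ, normAbs E (y : E) ≤ T → ψ ((y : E) * (y' : E)) = 1} := by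
  have h : {y' : skewPart σ | ∀ y : skewPart σ, normAbs E (y : E) ≤ T → ψ ((y : E) * (y' : E)) = 1} =
      ⋂ y : skewPart σ, ⋂ (_ : normAbs E (y : E) ≤ T), {y' : skewPart σ | ψ ((y : E) * (y' : E)) = 1} := by
    ext t; simp only [Set.mem_setOf_eq, Set.mem_iInter]
  rw [h]
  refine (isClosed_iInter fun y => isClosed_iInter fun _ => isClosed_eq ?_ continuous_const).measurableSet
  exact hψc.comp (continuous_const.mul continuous_subtype_val)

omit [Invertible (2 : E)] [T2Space E] [SecondCountableTopology E] [μm.Regular] in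
include hψc in
/-- **`∫_{E⁻} W_T dμ⁻ = μ⁻(B_T) · μ⁻(Ann_T)`.** [cite: Tate1950, §2.5] -/
theorem integral_W_eq (T : ℝ≥0) :
    ∫ y' : skewPart σ, (∫ y : skewPart σ, {y : skewPart σ | normAbs E (y : E) ≤ T}.indicator
        (fun y : skewPart σ => ((ψ ((y : E) * (y' : E)) : Circle) : ℂ)) y ∂μm) ∂μm =
      ((μm.real {y : skewPart σ | normAbs E (y : E) ≤ T} : ℝ) : ℂ) *
        ((μm.real {y' : skewPart σ | ∀ y : skewPart σ, normAbs E (y : E) ≤ T → ψ ((y : E) * (y' : E)) = 1} : ℝ) : ℂ) := by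
  classical
  simp_rw [integral_skewBall_addChar_mul_eq_mul_indicator σ ψ μm T]
  rw [integral_const_mul, integral_indicator_const _ (measurableSet_skewAnn σ ψ hψc T), Complex.real_smul, mul_one]

omit [Invertible (2 : E)] [MeasurableSpace E] [BorelSpace E] [T2Space E] [SecondCountableTopology E] in
/-- **`Ann_T` is small**: `Ann_T ⊆ {‖y'‖ < ‖a₁‖/T}` for a fixed `a₁` with `ψ(a₁) ≠ 1` (★ F4). [cite: WeilBNT1967, Ch. II §5] -/
theorem skewAnn_subset_ball {a₁ : E} (ha₁ : σ a₁ = a₁) (hψa₁ : ψ a₁ ≠ 1) {T : ℝ≥0} (hT : 0 < T) {y' : skewPart σ}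
    (hy' : ∀ y : skewPart σ, normAbs E (y : E) ≤ T → ψ ((y : E) * (y' : E)) = 1) : normAbs E (y' : E) < normAbs E a₁ / T :=
  normAbs_lt_of_forall_skew_addChar_mul_eq_one σ ψ ha₁ hψa₁ hT ((mem_skewPart_iff σ _).1 y'.2) fun y hy hle => hy' ⟨y, (mem_skewPart_iff σ y).2 hy⟩ hle

omit [Invertible (2 : E)] [MeasurableSpace E] [BorelSpace E] [T2Space E] [SecondCountableTopology E] in
/-- **`Ann_T` contains the `r_ψ/T`-ball** (★ F4 `addChar_mul_eq_one_of_normAbs_le`). [cite: Tate1950, §2.2] -/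
theorem ball_subset_skewAnn {rψ : ℝ≥0} (hrψ : ∀ z : E, normAbs E z ≤ rψ → ψ z = 1) {T : ℝ≥0} (hT : 0 < T) :
    {y' : skewPart σ | normAbs E (y' : E) ≤ rψ / T} ⊆ {y' : skewPart σ | ∀ y : skewPart σ, normAbs E (y : E) ≤ T → ψ ((y : E) * (y' : E)) = 1} :=
  fun _ hy' _ hy => addChar_mul_eq_one_of_normAbs_le ψ hrψ hT hy hy'

end SkewFactor

/-! ## §2 The dual zeta integral in closed form -/

section ClosedForm

open scoped Classical in
omit [μm.Regular] in
include hψc hψσ in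
/-- **THE DUAL ZETA INTEGRAL IN CLOSED FORM.**  Let `g_T(x) = Φ(½(x+σx)) 𝟙[‖½(x−σx)‖ ≤ T]` with the two-bump `Φ(a) = ψ(−a)𝟙_B(a) − ψ(−c₀a)𝟙_B(c₀a)` (`B = {‖·‖ ≤ ρ}`, `c₀` a fixed
unit), `ψ` continuous `σ`-even, `a₁` fixed with `ψ(a₁) ≠ 1`, `D̄` measurable multiplicative with `D̄(1+t) = 1` for `‖t‖ ≤ r₁`, and assume `‖a₁‖/ρ ≤ r₁`, `‖a₁‖/T ≤ r₁`,
`‖a₁‖/T ≤ r₁ ‖c₀‖`.  Then, for `μ_E = (μ⁺ ⊗ μ⁻) ∘ ringDecomp⁻¹`,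
`∫_E (g_T)^(β) D̄(β) dμ_E(β) = μ⁻(B_T) μ⁻(Ann_T) · μ⁺(B) μ⁺(𝔞) (1 − D̄(c₀))`.
Proof: `(g_T)^(a'+y') = F_Φ(a') W_T(y')` (★ F4), and on its support `D̄(a'+y') = D̄(a')` (`a' ∈ (1+𝔞) ∪ c₀(1+𝔞)`, `y' ∈ Ann_T`, both `r₁`-small), so the integrand is
`(F_Φ D̄)(a') · W_T(y')` and `∫ f ⊗ g = ∫ f · ∫ g` with ★ F4b and §1. [cite: Tate1950, §2.4, Lemma 2.4.3; §2.5] [cite: Keys1984, §5] -/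
theorem integral_fourierSB_truncTest_mul_eq (ρ : ℝ≥0) (hρ : 0 < ρ) (c₀ : Eˣ) (hc₀ : σ (c₀ : E) = c₀)
    {a₁ : E} (ha₁ : σ a₁ = a₁) (hψa₁ : ψ a₁ ≠ 1) (Dbar : E → ℂ) (hDm : Measurable Dbar) {C : ℝ} (hDb : ∀ b, ‖Dbar b‖ ≤ C)
    (hDmul : ∀ a b, Dbar (a * b) = Dbar a * Dbar b) {r₁ : ℝ≥0} (hD1 : ∀ t : E, normAbs E t ≤ r₁ → Dbar (1 + t) = 1)
    (hρr : normAbs E a₁ / ρ ≤ r₁) {T : ℝ≥0} (hT : 0 < T) (hT₁ : normAbs E a₁ / T ≤ r₁) (hT₂ : normAbs E a₁ / T ≤ r₁ * normAbs E (c₀ : E))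
    (Φ : E → ℂ) (hΦ : Φ = fun a : E => ((ψ (-a) : Circle) : ℂ) * {x : E | normAbs E x ≤ ρ}.indicator (fun _ => (1 : ℂ)) a -
      ((ψ (-((c₀ : E) * a)) : Circle) : ℂ) * {x : E | normAbs E x ≤ ρ}.indicator (fun _ => (1 : ℂ)) ((c₀ : E) * a)) :
    ∫ β, fourierSB ψ ((μp.prod μm).map (ringDecomp σ hσ hσc).symm)
        (fun x => Φ (⅟(2 : E) * (x + σ x)) * {y : E | normAbs E y ≤ T}.indicator (fun _ => (1 : ℂ)) (⅟(2 : E) * (x - σ x))) β * Dbar β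
        ∂((μp.prod μm).map (ringDecomp σ hσ hσc).symm) =
      (((μm.real {y : skewPart σ | normAbs E (y : E) ≤ T} : ℝ) : ℂ) *
          ((μm.real {y' : skewPart σ | ∀ y : skewPart σ, normAbs E (y : E) ≤ T → ψ ((y : E) * (y' : E)) = 1} : ℝ) : ℂ)) *
        (((μp.real {a : fixedPart σ | normAbs E (a : E) ≤ ρ} : ℝ) : ℂ) *
          ((μp.real {t : fixedPart σ | ∀ a : fixedPart σ, normAbs E (a : E) ≤ ρ → ψ ((a : E) * (t : E)) = 1} : ℝ) : ℂ) * (1 - Dbar (c₀ : E))) := by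
  haveI := locallyCompactSpace_fixedPart σ hσc
  haveI := locallyCompactSpace_skewPart σ hσc
  haveI : SecondCountableTopology (fixedPart σ) := TopologicalSpace.Subtype.secondCountableTopology _
  haveI : SecondCountableTopology (skewPart σ) := TopologicalSpace.Subtype.secondCountableTopology _
  have h2 : (⅟(2 : E)) * 2 = 1 := invOf_mul_self _
  set e := ringDecomp σ hσ hσc with he
  set meq : fixedPart σ × skewPart σ ≃ᵐ E := e.symm.toHomeomorph.toMeasurableEquiv with hmeq
  have hμ : ((μp.prod μm).map (ringDecomp σ hσ hσc).symm) = (μp.prod μm).map meq := rfl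
  -- the factors on `E⁺` and `E⁻`
  set FΦ : fixedPart σ → ℂ := fun a' => ((μp.real {a : fixedPart σ | normAbs E (a : E) ≤ ρ} : ℝ) : ℂ) *
    ((if (∀ a : fixedPart σ, normAbs E (a : E) ≤ ρ → ψ ((a : E) * ((a' : E) - 1)) = 1) then (1 : ℂ) else 0) -
      ((((fixedModulus σ hσc c₀ hc₀)⁻¹ : ℝ≥0) : ℝ) : ℂ) *
        (if (∀ a : fixedPart σ, normAbs E (a : E) ≤ ρ → ψ ((a : E) * ((a' : E) * (c₀ : E)⁻¹ - 1)) = 1) then (1 : ℂ) else 0)) with hFΦ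
  set W : skewPart σ → ℂ := fun y' => ((μm.real {y : skewPart σ | normAbs E (y : E) ≤ T} : ℝ) : ℂ) *
    {y' : skewPart σ | ∀ y : skewPart σ, normAbs E (y : E) ≤ T → ψ ((y : E) * (y' : E)) = 1}.indicator (fun _ => (1 : ℂ)) y' with hW
  -- local constancy of `D̄` on the support
  have hloc : ∀ (a' : fixedPart σ) (y' : skewPart σ), FΦ a' ≠ 0 → W y' ≠ 0 → Dbar ((a' : E) + (y' : E)) = Dbar (a' : E) := by
    intro a' y' hF hWy
    have hy'A : y' ∈ {y' : skewPart σ | ∀ y : skewPart σ, normAbs E (y : E) ≤ T → ψ ((y : E) * (y' : E)) = 1} := by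
      by_contra h; exact hWy (by rw [hW]; dsimp only; rw [Set.indicator_of_notMem h, mul_zero])
    have hy's : normAbs E (y' : E) < normAbs E a₁ / T := skewAnn_subset_ball σ ψ ha₁ hψa₁ hT hy'A
    by_cases h1 : ∀ a : fixedPart σ, normAbs E (a : E) ≤ ρ → ψ ((a : E) * ((a' : E) - 1)) = 1
    · -- first bump: `a' = 1 + t`
      have hfix : σ ((a' : E) - 1) = (a' : E) - 1 := by rw [map_sub, map_one, show σ (a' : E) = a' from a'.2]
      have ht : normAbs E ((a' : E) - 1) < normAbs E a₁ / ρ :=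
        normAbs_lt_of_forall_fixed_addChar_mul_eq_one σ ψ ha₁ hψa₁ hρ hfix fun a ha hle => h1 ⟨a, ha⟩ hle
      have hD' : Dbar (a' : E) = 1 := by
        have := hD1 _ (le_trans ht.le hρr); rwa [add_sub_cancel] at this
      have hsum : normAbs E (((a' : E) - 1) + (y' : E)) ≤ r₁ :=
        (normAbs_add_le_max _ _).trans (max_le (le_trans ht.le hρr) (le_trans hy's.le hT₁))
      have := hD1 _ hsum
      rw [show (1 : E) + (((a' : E) - 1) + (y' : E)) = (a' : E) + (y' : E) by ring] at this
      rw [hD', this]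
    · by_cases h2' : ∀ a : fixedPart σ, normAbs E (a : E) ≤ ρ → ψ ((a : E) * ((a' : E) * (c₀ : E)⁻¹ - 1)) = 1
      · -- second bump: `a' = c₀ (1 + t)`
        have hc₀n : 0 < normAbs E (c₀ : E) := pos_iff_ne_zero.2 ((map_ne_zero _).2 c₀.ne_zero)
        have hfix : σ ((a' : E) * (c₀ : E)⁻¹ - 1) = (a' : E) * (c₀ : E)⁻¹ - 1 := by
          rw [map_sub, map_one, map_mul, map_inv₀, hc₀, show σ (a' : E) = a' from a'.2]
        have ht : normAbs E ((a' : E) * (c₀ : E)⁻¹ - 1) < normAbs E a₁ / ρ :=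
          normAbs_lt_of_forall_fixed_addChar_mul_eq_one σ ψ ha₁ hψa₁ hρ hfix fun a ha hle => h2' ⟨a, ha⟩ hle
        have hyc : normAbs E ((c₀ : E)⁻¹ * (y' : E)) ≤ r₁ := by
          rw [map_mul, map_inv₀, inv_mul_le_iff₀ hc₀n]
          exact le_trans hy's.le (by rwa [mul_comm] at hT₂)
        have hsum : normAbs E (((a' : E) * (c₀ : E)⁻¹ - 1) + (c₀ : E)⁻¹ * (y' : E)) ≤ r₁ :=
          (normAbs_add_le_max _ _).trans (max_le (le_trans ht.le hρr) hyc)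
        have hA : Dbar (a' : E) = Dbar (c₀ : E) := by
          have heq : (c₀ : E) * (1 + ((a' : E) * (c₀ : E)⁻¹ - 1)) = (a' : E) := by rw [add_sub_cancel, mul_comm, inv_mul_cancel_right₀ c₀.ne_zero]
          rw [← heq, hDmul, hD1 _ (le_trans ht.le hρr), mul_one]
        have heq' : (c₀ : E) * (1 + (((a' : E) * (c₀ : E)⁻¹ - 1) + (c₀ : E)⁻¹ * (y' : E))) = (a' : E) + (y' : E) := by
          calc (c₀ : E) * (1 + (((a' : E) * (c₀ : E)⁻¹ - 1) + (c₀ : E)⁻¹ * (y' : E)))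
              = ((c₀ : E) * (c₀ : E)⁻¹) * (a' : E) + ((c₀ : E) * (c₀ : E)⁻¹) * (y' : E) := by ring
            _ = (a' : E) + (y' : E) := by rw [mul_inv_cancel₀ c₀.ne_zero, one_mul, one_mul]
        rw [← heq', hDmul, hD1 _ hsum, mul_one, hA]
      · exact absurd (by rw [hFΦ]; dsimp only; rw [if_neg h1, if_neg h2']; ring) hF
  -- the pointwise product structure of the integrand
  have hFΦ' : ∀ a' : fixedPart σ, ∫ a : fixedPart σ, ((ψ ((a : E) * (a' : E)) : Circle) : ℂ) * Φ (a : E) ∂μp = FΦ a' := by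
    intro a'
    simp only [hΦ]
    exact integral_addChar_mul_twoBump σ hσc ψ hψc μp ρ c₀ hc₀ (a' : E)
  have hpt : ∀ p : fixedPart σ × skewPart σ,
      fourierSB ψ ((μp.prod μm).map (ringDecomp σ hσ hσc).symm)
        (fun x => Φ (⅟(2 : E) * (x + σ x)) * {y : E | normAbs E y ≤ T}.indicator (fun _ => (1 : ℂ)) (⅟(2 : E) * (x - σ x))) (meq p) * Dbar (meq p) =
        (FΦ p.1 * Dbar ((p.1 : fixedPart σ) : E)) * W p.2 := by
    rintro ⟨a', y'⟩
    have hav : meq (a', y') = (a' : E) + (y' : E) := rfl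
    have ha' : σ (a' : E) = a' := a'.2
    have hy' : σ (y' : E) = -(y' : E) := (mem_skewPart_iff σ _).1 y'.2
    rw [hav, fourierSB_truncTest_eq_mul σ hσ hσc ψ hψσ μp μm Φ T ((a' : E) + (y' : E)), re_add σ ha' hy', im_add σ ha' hy',
      hFΦ' a', integral_skewBall_addChar_mul_eq_mul_indicator σ ψ μm T y']
    change FΦ a' * W y' * Dbar ((a' : E) + (y' : E)) = (FΦ a' * Dbar (a' : E)) * W y'
    by_cases hF : FΦ a' = 0
    · rw [hF]; ring
    · by_cases hWy : W y' = 0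
      · rw [hWy]; ring
      · rw [hloc a' y' hF hWy]; ring
  set FT : E → ℂ := fourierSB ψ ((μp.prod μm).map (ringDecomp σ hσ hσc).symm)
    (fun x => Φ (⅟(2 : E) * (x + σ x)) * {y : E | normAbs E y ≤ T}.indicator (fun _ => (1 : ℂ)) (⅟(2 : E) * (x - σ x))) with hFT
  rw [hμ, integral_map_equiv meq]
  simp_rw [hpt]
  have hWint : ∫ y' : skewPart σ, W y' ∂μm = ((μm.real {y : skewPart σ | normAbs E (y : E) ≤ T} : ℝ) : ℂ) *
      ((μm.real {y' : skewPart σ | ∀ y : skewPart σ, normAbs E (y : E) ≤ T → ψ ((y : E) * (y' : E)) = 1} : ℝ) : ℂ) := by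
    rw [hW, integral_const_mul, integral_indicator_const _ (measurableSet_skewAnn σ ψ hψc T), Complex.real_smul, mul_one]
  rw [integral_prod_mul (fun a' : fixedPart σ => FΦ a' * Dbar ((a' : fixedPart σ) : E)) W,
    integral_twoBumpTransform_mul_eq σ hσc ψ hψc μp ρ hρ c₀ hc₀ ha₁ hψa₁ Dbar hDm hDb hDmul hD1 hρr, hWint]
  ring

end ClosedForm

/-! ## §3 The lower bound: `μ⁻(B_T) μ⁻{‖y‖ ≤ r/T}` is constant along `T = ‖l‖^k T₀` -/

section LowerBound

omit [Invertible (2 : E)] [SecondCountableTopology E] [μp.IsAddHaarMeasure] [μp.Regular] in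
/-- **`μ⁻{‖y‖ ≤ ‖l‖^k r} = χ⁻(l)^k μ⁻{‖y‖ ≤ r}`** (★ F2 `measure_skewBall_le_eq`, iterated). [cite: WeilBNT1967, Ch. I §2] -/
theorem measure_skewBall_pow_mul (l : Eˣ) (hl : σ (l : E) = l) (r : ℝ≥0) (k : ℕ) :
    μm {y : skewPart σ | normAbs E (y : E) ≤ normAbs E (l : E) ^ k * r} = skewModulus σ hσc l hl ^ k * μm {y : skewPart σ | normAbs E (y : E) ≤ r} := by
  induction k with
  | zero => rw [pow_zero, one_mul, pow_zero, one_mul]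
  | succ k ih => rw [pow_succ', mul_assoc, measure_skewBall_le_eq σ hσc μm l hl, ih, pow_succ', mul_assoc]

omit [Invertible (2 : E)] [SecondCountableTopology E] [μp.IsAddHaarMeasure] [μp.Regular] in
include hσc in
/-- **THE PRODUCT `μ⁻{‖y‖ ≤ ‖l‖^k T₀} · μ⁻{‖y‖ ≤ r/(‖l‖^k T₀)}` IS INDEPENDENT OF `k`**: scaling the first ball up by `l^k` multiplies its mass by `χ⁻(l)^k`, scaling the second
down divides by the same (`T₀ > 0`). [cite: WeilBNT1967, Ch. I §2] -/
theorem measure_skewBall_mul_measure_skewBall_eq (l : Eˣ) (hl : σ (l : E) = l) {T₀ : ℝ≥0} (hT₀ : 0 < T₀) (r : ℝ≥0) (k : ℕ) :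
    μm {y : skewPart σ | normAbs E (y : E) ≤ normAbs E (l : E) ^ k * T₀} * μm {y : skewPart σ | normAbs E (y : E) ≤ r / (normAbs E (l : E) ^ k * T₀)} =
      μm {y : skewPart σ | normAbs E (y : E) ≤ T₀} * μm {y : skewPart σ | normAbs E (y : E) ≤ r / T₀} := by
  haveI := locallyCompactSpace_skewPart σ hσc
  have hl0 : 0 < normAbs E (l : E) := pos_iff_ne_zero.2 ((map_ne_zero _).2 l.ne_zero)
  have hQk : 0 < normAbs E (l : E) ^ k := pow_pos hl0 k
  have h1 := measure_skewBall_pow_mul σ hσc μm l hl T₀ k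
  have h2 : μm {y : skewPart σ | normAbs E (y : E) ≤ r / T₀} = skewModulus σ hσc l hl ^ k * μm {y : skewPart σ | normAbs E (y : E) ≤ r / (normAbs E (l : E) ^ k * T₀)} := by
    have := measure_skewBall_pow_mul σ hσc μm l hl (r / (normAbs E (l : E) ^ k * T₀)) k
    rwa [show normAbs E (l : E) ^ k * (r / (normAbs E (l : E) ^ k * T₀)) = r / T₀ by field_simp] at this
  rw [h1, h2]
  ring

end LowerBound

end Summit.HodgeConjecture.HodgeConjecture.Cruxes.H413.K2E3DualZetaEvaluation

end
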